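import Summits.QuantumFields.YangMills.Theorems.BalabanUVNodesN17ShiftModulusCrossoverU2

/-!
# NODE N17 (NE4) → THE N19′ CORE EDGE OF K3⁷, PART 3: NODE U2's MAIN (FADING-MEMORY) FORM UNDER A GENERAL SCALE-SHIFT MODULUS — the two-sided fixed point
# closes for every θ-REGULAR ENVELOPE of the modulus' tails; the injected modulus is twice the envelope

Cell `pub-ymgap`, YM-PLAN Track A (HUMAN RULING D-0062 ∕ D-0149), WIDTH SEAT `pub-ymgap-dag-n17-w2` (gen 3), key K3⁷ stmt-QuantumFields-20544
(`--kind proof --supports 20544 --as helper`, COUNT-NEUTRAL).  PART 1 (`…N17ShiftModulusCrossover`): the N19′-side transport threshold.  PART 2 (`…CrossoverU2`):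
node U2's LAST-ONLY Grönwall form under a general modulus `μ` of the full β (injected modulus = the tails of `μ`).  THIS PART does the same for node U2's MAIN
form — the FADING-MEMORY feedback of the history moduli (`T4CouplingMatching.disc_le_of_fadingMemory`: `HistLipschitz Λ γ β` with `FadingMemory C θ Λ`, the
two-sided fixed point `twoSided_fixedPoint`), whose tree proof closes ONLY for the geometric source `c·θ^j` (weighted maximum `max δ_i θ^{−i}`).  Here the source is a
general modulus and the fixed point is closed against an ENVELOPE `x` of its windows: `x > 0` ANTITONE, dominating `Σ_{i∈[j,K)} μ_i ≤ x_j`, and θ-REGULAR —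
`θ^{j−i}·x_i ≤ κ·x_j` for `i ≤ j` (the envelope decays NO FASTER than the memory fades; every geometric `ρ^j` with `ρ ≥ θ`, every stretched-geometric and every
polynomial envelope qualifies) — under the smallness `C·κ·U ≤ (1−θ)∕2` in place of the tree's `C·U ≤ (1−θ)∕2`.  The one new idea w.r.t. the tree proof: sum the
recursion FIRST and EXCHANGE the memory sum (`exchange_memory_sum`: `Σ_{j'∈[j,K)} Σ_{i≤j'} θ^{j'−i} w_i ≤ (1−θ)⁻¹·(Σ_{i<j} θ^{j−i} w_i + Σ_{i∈[j,K)} w_i)`), then take the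
weighted maximum `max δ_i ∕ x_i`.

WHAT THIS FILE PROVES (theorems only; 0 `def`, 0 `instance`, 0 `notation`, 0 `sorry`).
§1 kernel: `sum_Ico_pow_sub_le` (shifted geometric window), ★ `exchange_memory_sum`, ★★ `twoSided_fixedPoint_envelope` (the abstract two-sided kernel with a general
source and a θ-regular antitone envelope: `δ_j ≤ 2·x_j`).
§2 ★★ `disc_le_envelope_of_fadingMemory_shiftModulus` — NODE U2, MAIN FORM, under a scale-shift MODULUS: two IR-pinned runs of (0.20), `HistLipschitz` + `FadingMemory C θ Λ`,
weights `Σ_{i≤K}(g^A_i)²g^B_{i+1} ≤ U`, envelope `x` as above, `C·κ·U ≤ (1−θ)∕2` ⟹ `disc gA gB j ≤ 2·x_j` (`j ≤ K`).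
§3 ★ `injectedModulus_of_runs_fadingMemory_shiftModulus` (family of runs, eventual AF floor: `U = (k₀+1)γ³ + 2γ∕b`; the K-uniform injected modulus is `2·x`) and
★★ `summable_crossover_of_runs_fadingMemory_shiftModulus` (junction with PART 1: envelope `p`-summable at an admissible exponent ⟹ the crossover with the ACTUAL
discrepancies is summable over `K`).
§4 the geometric instance ★ `summable_crossover_of_runs_fadingMemory_scaleShiftRate`: NE4 AS TYPED (`ScaleShiftRate c θ γ β`, one `θ` shared with the memory as in
the tree) with envelope `((c+1)∕(1−θ))·θ^j` (`κ = 1`) ⟹ summable crossover for every `0 < a < 1`, `Λ ≥ 0` under the tree's own smallness `C·U ≤ (1−θ)∕2` — node U2's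
main form is consistent with the edge of record through the modulus road as well.

WHAT IT SAYS FOR K3⁷ (LOCATED; no stub text changes).  On BOTH readings of node U2 (PART 2 last-only, PART 3 fading memory) what the N19′ crossover needs of node
N17 is an ENVELOPE of the full-β shift modulus' tails that is `p`-summable at an admissible exponent `p < σ⋆(a, Λ)` (PART 1) — and on the fading-memory reading the
envelope must moreover decay no faster than the memory rate `θ`; NE4's geometric rate is the natural such envelope; a summable-but-polynomial modulus (gen 2's
`1∕(k+1)²` witness) is admissible as an ENVELOPE here (θ-regular, antitone) but its tails are `p`-summable for no `p ≤ 1` (PART 2 `tails_inv_sq_not_rpowSummable`), so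
it hands the crossover nothing on either reading.

HONEST SCOPE (A6, director-ym №189).  Upper bounds only; elementary real analysis ([folklore]) over hypothesis SHAPES.  INHABITATION (v1.1, answering ref-N g5
READ-41 row 128 A2 «no witness decl named»): §4 discharges the ENVELOPE letters only; the RUN ∕ β ∕ memory ∕ smallness binders of §2–§4 are jointly inhabited BY NAME —
explicitly on the scale-dependent history-FLAT family `β k v = b + cθ^k` (exact discrepancy `c(θ^j − θ^K)`) and WITH NONZERO FADING MEMORY by `b + cθ^k + ε·tower θ k v`
— in the companion module `…Theorems.BalabanUVNodesN17ShiftModulusCrossoverWitness` (`inhabits_injectedModulus_fadingMemory`, `inhabits_crossover_fadingMemory`,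
`inhabits_crossover_fadingMemory_numeric`, `exists_histDep_inhabitant_fadingMemory`); NOTHING is inhabited at Bałaban's β.  Nothing of Bałaban asserted or
instantiated; NE4 ∕ `HistLipschitz` ∕ `FadingMemory` ∕ `EventualLowerH` ∕ NE7 NOT PRINTED as used ([Balaban1987RG1] p. 264, §5 p. 298: the dependence on preceding
couplings «exists», no modulus) and NOT proved; no K2⁷∕K3⁷ stub proved; N17 ∕ N19 NOT discharged; K2⁷ ∕ K3⁷ OPEN; counts UNMOVED (typed 28∕28 · discharged 5∕28).  One finite four-torus programme at fixed `ε = L^{−K}`, Bałaban AS PRINTED; the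
YM mass gap (Clay) is NOT proved by any of this — R4 closes the conditional finite-𝕋⁴ rung `BalabanLadder.UV` only; nothing continuum ∕ ℝ⁴ ∕ OS.
References: [Balaban1987RG1] T. Bałaban, Commun. Math. Phys. **109** (1987), (0.20) p. 256, Thm 2 and (0.31) p. 259 (PDF 11; v1.1 NIT-CITE repair of «(0.31) p. 258», ref-N g5
READ-41), §1 p. 264, §5 p. 298.  EDITION v1.1 (gen 5): docstring-only — the seven theorem statements and proofs are byte-identical to v1 (p599524).
-/

noncomputable section

namespace Summit.QuantumFields.YangMills.BalabanUVNodes.N17ShiftModulusCrossoverU2Fading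

open Literature.MathematicalPhysics.QuantumFieldTheory.Balaban1983to89
open Literature.MathematicalPhysics.QuantumFieldTheory.Balaban1983to89.FlowStep
open Literature.MathematicalPhysics.QuantumFieldTheory.Balaban1983to89.T4CouplingMatching
open Summit.QuantumFields.YangMills.BalabanUVNodes.N17ShiftModulusCrossover
  (summable_crossover_of_injectedModulus_rpowSummable rpowSummable_of_geometric_modulus exists_crossover_admissible_exponent)
open Summit.QuantumFields.YangMills.BalabanUVNodes.N17ShiftModulusAnchor (shiftModulus_nonneg)
open Summit.QuantumFields.YangMills.BalabanUVNodes.N17ShiftModulusCrossoverU2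
  (disc_step_of_shiftModulus sum_Ico_le_tsum_tail tsum_tail_nonneg summable_of_geometric_shiftModulus tail_le_of_geometric_shiftModulus)
open Finset

/-! ## §1 Kernel: the exchanged memory sum and the two-sided fixed point with an envelope -/

/-- a shifted geometric window: for `i ≤ m`, `0 ≤ θ < 1`, `Σ_{j'∈[m,K)} θ^{j'−i} ≤ θ^{m−i}∕(1−θ)`. [folklore] -/
theorem sum_Ico_pow_sub_le {θ : ℝ} (hθ0 : 0 ≤ θ) (hθ1 : θ < 1) {i m : ℕ} (him : i ≤ m) (K : ℕ) :
    ∑ j' ∈ Ico m K, θ ^ (j' - i) ≤ θ ^ (m - i) / (1 - θ) := by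
  rw [Finset.sum_Ico_eq_sum_range]
  have e : ∀ k ∈ range (K - m), θ ^ (m + k - i) = θ ^ (m - i) * θ ^ k := fun k _ => by
    rw [← pow_add]; congr 1; omega
  rw [Finset.sum_congr rfl e, ← Finset.mul_sum]
  have hg : ∑ k ∈ range (K - m), θ ^ k ≤ 1 / (1 - θ) := by
    have h := geom_sum_Ico_le_of_lt_one (m := 0) (n := K - m) hθ0 hθ1
    rwa [← Finset.range_eq_Ico, pow_zero] at h
  calc θ ^ (m - i) * ∑ k ∈ range (K - m), θ ^ k ≤ θ ^ (m - i) * (1 / (1 - θ)) := mul_le_mul_of_nonneg_left hg (pow_nonneg hθ0 _)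
    _ = θ ^ (m - i) / (1 - θ) := by rw [mul_one_div]

/-- ★ **THE EXCHANGED MEMORY SUM**: for `0 ≤ θ < 1`, weights `w_i ≥ 0` (`i < K`) and `j ≤ K`,
`Σ_{j'∈[j,K)} Σ_{i≤j'} θ^{j'−i}·w_i ≤ (1−θ)⁻¹·(Σ_{i<j} θ^{j−i}·w_i + Σ_{i∈[j,K)} w_i)` — exchange the sums (`Finset.sum_comm'`: `i < K`, `j' ∈ [max(i,j), K)`) and sum the
memory kernel geometrically in `j'`. [folklore] -/
theorem exchange_memory_sum {θ : ℝ} {w : ℕ → ℝ} (hθ0 : 0 ≤ θ) (hθ1 : θ < 1) {j K : ℕ} (hw : ∀ i, i < K → 0 ≤ w i) (hjK : j ≤ K) :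
    ∑ j' ∈ Ico j K, ∑ i ∈ range (j' + 1), θ ^ (j' - i) * w i
      ≤ (1 - θ)⁻¹ * (∑ i ∈ range j, θ ^ (j - i) * w i + ∑ i ∈ Ico j K, w i) := by
  have hex : ∑ j' ∈ Ico j K, ∑ i ∈ range (j' + 1), θ ^ (j' - i) * w i
      = ∑ i ∈ range K, ∑ j' ∈ Ico (max i j) K, θ ^ (j' - i) * w i := by
    refine Finset.sum_comm' fun j' i => ?_
    simp only [Finset.mem_Ico, Finset.mem_range, max_le_iff]
    omega
  rw [hex]
  have h1θ : 0 < 1 - θ := by linarith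
  have hinner : ∀ i ∈ range K, ∑ j' ∈ Ico (max i j) K, θ ^ (j' - i) * w i ≤ (1 - θ)⁻¹ * (θ ^ (max i j - i) * w i) := by
    intro i hi
    rw [← Finset.sum_mul]
    have hgeom := sum_Ico_pow_sub_le hθ0 hθ1 (le_max_left i j) K
    calc (∑ j' ∈ Ico (max i j) K, θ ^ (j' - i)) * w i ≤ θ ^ (max i j - i) / (1 - θ) * w i :=
          mul_le_mul_of_nonneg_right hgeom (hw i (mem_range.mp hi))
      _ = (1 - θ)⁻¹ * (θ ^ (max i j - i) * w i) := by rw [div_eq_mul_inv]; ring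
  calc ∑ i ∈ range K, ∑ j' ∈ Ico (max i j) K, θ ^ (j' - i) * w i
      ≤ ∑ i ∈ range K, (1 - θ)⁻¹ * (θ ^ (max i j - i) * w i) := Finset.sum_le_sum hinner
    _ = (1 - θ)⁻¹ * ∑ i ∈ range K, θ ^ (max i j - i) * w i := by rw [Finset.mul_sum]
    _ = (1 - θ)⁻¹ * (∑ i ∈ range j, θ ^ (j - i) * w i + ∑ i ∈ Ico j K, w i) := by
        congr 1
        rw [Finset.range_eq_Ico, ← Finset.sum_Ico_consecutive _ (Nat.zero_le j) hjK, ← Finset.range_eq_Ico]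
        congr 1
        · refine Finset.sum_congr rfl fun i hi => ?_
          rw [max_eq_right (mem_range.mp hi).le]
        · refine Finset.sum_congr rfl fun i hi => ?_
          rw [max_eq_left (Finset.mem_Ico.mp hi).1, Nat.sub_self, pow_zero, one_mul]

/-- ★★ **THE TWO-SIDED KERNEL WITH A GENERAL SOURCE AND A θ-REGULAR ENVELOPE** (envelope edition of `T4CouplingMatching.twoSided_fixedPoint`).  For `0 ≤ θ < 1`,
`C ≥ 0`, `δ ≥ 0` with `δ_K = 0`, weights `u_i ≥ 0` (`i ≤ K`) with `Σ_{i≤K} u_i ≤ U`, a source `μ` whose windows are dominated by an envelope `x`,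
`Σ_{i∈[j,K)} μ_i ≤ x_j` (`j ≤ K`), where `x > 0` is ANTITONE and θ-REGULAR (`θ^{j−i}·x_i ≤ κ·x_j` for `i ≤ j`), the SMALLNESS `C·κ·U ≤ (1−θ)∕2`, and the recursion
`δ_j ≤ δ_{j+1} + μ_j + C·Σ_{i≤j} θ^{j−i}·u_i·δ_i` (`j < K`): `δ_j ≤ 2·x_j` for every `j ≤ K`.  Proof: sum backwards (`backward_sum`), exchange the memory sum
(`exchange_memory_sum`), bound `δ_i ≤ M·x_i` with the weighted maximum `M = max_{i≤K} δ_i∕x_i`, use regularity for `i < j` and antitonicity for `i ≥ j`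
(`κ ≥ 1` automatically): `δ_j ≤ x_j·(1 + M∕2)`, whence `M ≤ 2` at the maximiser. [folklore] -/
theorem twoSided_fixedPoint_envelope {K : ℕ} {δ u μ x : ℕ → ℝ} {θ C U κ : ℝ} (hθ0 : 0 ≤ θ) (hθ1 : θ < 1) (hC : 0 ≤ C)
    (hδ : ∀ j, 0 ≤ δ j) (hu : ∀ i, i ≤ K → 0 ≤ u i) (hU : ∑ i ∈ range (K + 1), u i ≤ U)
    (hx : ∀ j, 0 < x j) (hanti : ∀ i j, i ≤ j → x j ≤ x i) (hreg : ∀ i j, i ≤ j → θ ^ (j - i) * x i ≤ κ * x j)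
    (hsrc : ∀ j, j ≤ K → ∑ i ∈ Ico j K, μ i ≤ x j) (hsmall : C * κ * U ≤ (1 - θ) / 2) (hK : δ K = 0)
    (hrec : ∀ j, j < K → δ j ≤ δ (j + 1) + μ j + C * ∑ i ∈ range (j + 1), θ ^ (j - i) * u i * δ i) :
    ∀ j, j ≤ K → δ j ≤ 2 * x j := by
  have h1θ : 0 < 1 - θ := by linarith
  -- κ ≥ 1 (regularity at `i = j`)
  have hκ : 1 ≤ κ := by
    have h := hreg 0 0 le_rfl
    rw [Nat.sub_self, pow_zero, one_mul] at h
    nlinarith [hx 0]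
  have hU0 : 0 ≤ U := (Finset.sum_nonneg fun i hi => hu i (Nat.lt_succ_iff.mp (mem_range.mp hi))).trans hU
  -- the weighted maximum
  have hne : (range (K + 1)).Nonempty := ⟨0, by simp⟩
  set M := (range (K + 1)).sup' hne (fun i => δ i / x i) with hM
  have hMi : ∀ i, i ≤ K → δ i ≤ M * x i := by
    intro i hi
    have h : δ i / x i ≤ M := Finset.le_sup' (fun i => δ i / x i) (mem_range.mpr (Nat.lt_succ_of_le hi))
    rwa [div_le_iff₀ (hx i)] at h
  have hM0 : 0 ≤ M := by
    have h : δ 0 / x 0 ≤ M := Finset.le_sup' (fun i => δ i / x i) (mem_range.mpr (Nat.succ_pos K))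
    exact (div_nonneg (hδ 0) (hx 0).le).trans h
  -- backward summation of the recursion
  have hback := backward_sum (δ := δ) (s := fun j => μ j + C * ∑ i ∈ range (j + 1), θ ^ (j - i) * u i * δ i) (le_of_eq hK)
    (fun j hj => by linarith [hrec j hj])
  -- the main estimate: `δ_j ≤ x_j (1 + C κ U M /(1−θ))`
  have hmain : ∀ j, j ≤ K → δ j ≤ x j * (1 + C * κ * U * M / (1 - θ)) := by
    intro j hj
    have hb := hback j hj
    rw [Finset.sum_add_distrib, ← Finset.mul_sum] at hb
    -- exchange the memory sum, weights `w i = u i * δ i`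
    have hw : ∀ i, i < K → 0 ≤ u i * δ i := fun i hi => mul_nonneg (hu i hi.le) (hδ i)
    have hex := exchange_memory_sum (w := fun i => u i * δ i) hθ0 hθ1 hw hj
    have hex' : ∑ j' ∈ Ico j K, ∑ i ∈ range (j' + 1), θ ^ (j' - i) * u i * δ i
        ≤ (1 - θ)⁻¹ * (∑ i ∈ range j, θ ^ (j - i) * (u i * δ i) + ∑ i ∈ Ico j K, u i * δ i) := by
      refine le_trans (le_of_eq ?_) hex
      refine Finset.sum_congr rfl fun j' _ => Finset.sum_congr rfl fun i _ => ?_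
      ring
    -- the two pieces against the envelope
    have hA : ∑ i ∈ range j, θ ^ (j - i) * (u i * δ i) ≤ M * κ * x j * ∑ i ∈ range j, u i := by
      rw [Finset.mul_sum]
      refine Finset.sum_le_sum fun i hi => ?_
      have hij : i < j := mem_range.mp hi
      have hiK : i ≤ K := by omega
      calc θ ^ (j - i) * (u i * δ i) ≤ θ ^ (j - i) * (u i * (M * x i)) :=
            mul_le_mul_of_nonneg_left (mul_le_mul_of_nonneg_left (hMi i hiK) (hu i hiK)) (pow_nonneg hθ0 _)
        _ = M * u i * (θ ^ (j - i) * x i) := by ring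
        _ ≤ M * u i * (κ * x j) := mul_le_mul_of_nonneg_left (hreg i j hij.le) (mul_nonneg hM0 (hu i hiK))
        _ = M * κ * x j * u i := by ring
    have hB : ∑ i ∈ Ico j K, u i * δ i ≤ M * κ * x j * ∑ i ∈ Ico j K, u i := by
      rw [Finset.mul_sum]
      refine Finset.sum_le_sum fun i hi => ?_
      have hji : j ≤ i := (Finset.mem_Ico.mp hi).1
      have hiK : i ≤ K := (Finset.mem_Ico.mp hi).2.le
      calc u i * δ i ≤ u i * (M * x i) := mul_le_mul_of_nonneg_left (hMi i hiK) (hu i hiK)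
        _ ≤ u i * (M * x j) := mul_le_mul_of_nonneg_left (mul_le_mul_of_nonneg_left (hanti j i hji) hM0) (hu i hiK)
        _ = M * 1 * x j * u i := by ring
        _ ≤ M * κ * x j * u i := by
            have : 0 ≤ M * x j * u i := mul_nonneg (mul_nonneg hM0 (hx j).le) (hu i hiK)
            nlinarith
    have hsumU : ∑ i ∈ range j, u i + ∑ i ∈ Ico j K, u i ≤ U := by
      rw [Finset.range_eq_Ico, Finset.sum_Ico_consecutive _ (Nat.zero_le j) hj, ← Finset.range_eq_Ico]
      calc ∑ i ∈ range K, u i ≤ ∑ i ∈ range (K + 1), u i :=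
            Finset.sum_le_sum_of_subset_of_nonneg (Finset.range_mono (Nat.le_succ K))
              (fun i hi _ => hu i (Nat.lt_succ_iff.mp (mem_range.mp hi)))
        _ ≤ U := hU
    have hMκx : 0 ≤ M * κ * x j := mul_nonneg (mul_nonneg hM0 (by linarith)) (hx j).le
    have hfeed : ∑ j' ∈ Ico j K, ∑ i ∈ range (j' + 1), θ ^ (j' - i) * u i * δ i ≤ (1 - θ)⁻¹ * (M * κ * x j * U) := by
      refine hex'.trans (mul_le_mul_of_nonneg_left ?_ (inv_nonneg.mpr h1θ.le))
      calc ∑ i ∈ range j, θ ^ (j - i) * (u i * δ i) + ∑ i ∈ Ico j K, u i * δ i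
          ≤ M * κ * x j * ∑ i ∈ range j, u i + M * κ * x j * ∑ i ∈ Ico j K, u i := add_le_add hA hB
        _ = M * κ * x j * (∑ i ∈ range j, u i + ∑ i ∈ Ico j K, u i) := by ring
        _ ≤ M * κ * x j * U := mul_le_mul_of_nonneg_left hsumU hMκx
    have hsrcj := hsrc j hj
    calc δ j ≤ ∑ i ∈ Ico j K, μ i + C * ∑ j' ∈ Ico j K, ∑ i ∈ range (j' + 1), θ ^ (j' - i) * u i * δ i := hb
      _ ≤ x j + C * ((1 - θ)⁻¹ * (M * κ * x j * U)) := add_le_add hsrcj (mul_le_mul_of_nonneg_left hfeed hC)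
      _ = x j * (1 + C * κ * U * M / (1 - θ)) := by rw [div_eq_mul_inv]; ring
  -- the fixed point: `M ≤ 1 + M/2`
  have hlam : C * κ * U / (1 - θ) ≤ 1 / 2 := by
    rw [div_le_iff₀ h1θ]; linarith
  obtain ⟨i₀, hi₀, hMi₀⟩ := Finset.exists_mem_eq_sup' hne (fun i => δ i / x i)
  have hi₀K : i₀ ≤ K := Nat.lt_succ_iff.mp (mem_range.mp hi₀)
  have hMle : M ≤ 1 + C * κ * U * M / (1 - θ) := by
    have h := hmain i₀ hi₀K
    have hx₀ := hx i₀
    calc M = δ i₀ / x i₀ := hMi₀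
      _ ≤ 1 + C * κ * U * M / (1 - θ) := by
          rw [div_le_iff₀ hx₀]
          linarith
  have hM2 : M ≤ 2 := by
    have h1 : C * κ * U * M / (1 - θ) = C * κ * U / (1 - θ) * M := by ring
    rw [h1] at hMle
    nlinarith [hlam, hM0]
  intro j hj
  calc δ j ≤ M * x j := hMi j hj
    _ ≤ 2 * x j := mul_le_mul_of_nonneg_right hM2 (hx j).le

/-! ## §2 NODE U2, MAIN FORM, under a scale-shift modulus with a θ-regular envelope -/

/-- ★★ **NODE U2, MAIN (FADING-MEMORY) FORM under a scale-shift MODULUS** (envelope edition of `T4CouplingMatching.disc_le_of_fadingMemory`).  Two runs of (0.20) with the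
same history-dependent family `β` — A: `K` steps, B: `K+1` steps — couplings in `]0,γ]`, pinned `g^A_K = g^B_{K+1}`; a modulus `μ` of the full β on the window; history
moduli `HistLipschitz Λ γ β` with `FadingMemory C θ Λ` (`0 ≤ θ < 1`); the AF weight bound `Σ_{i≤K}(g^A_i)²g^B_{i+1} ≤ U`; an ENVELOPE `x > 0`, antitone, θ-regular with
constant `κ`, dominating the windows `Σ_{i∈[j,K)} μ_i ≤ x_j`; SMALLNESS `C·κ·U ≤ (1−θ)∕2`.  THEN `disc gA gB j ≤ 2·x_j` for every `j ≤ K`.  (`§1` kernel at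
`δ = disc`, `u_i = (g^A_i)²g^B_{i+1}`, recursion = PART 2's `disc_step_of_shiftModulus` + the fading-memory bound on `Λ j i`.) [cite: Balaban1987RG1, (0.20) p.256 and §5 p.298] -/
theorem disc_le_envelope_of_fadingMemory_shiftModulus {β : HBeta} {γ C θ U κ : ℝ} {μ x : ℕ → ℝ} {Λ : ℕ → ℕ → ℝ} {K : ℕ} {gA gB : ℕ → ℝ}
    (hθ0 : 0 ≤ θ) (hθ1 : θ < 1) (hC : 0 ≤ C)
    (hA : RGEqH K β gA) (hB : RGEqH (K + 1) β gB)
    (hAbox : ∀ i, i ≤ K → 0 < gA i ∧ gA i ≤ γ) (hBbox : ∀ i, i ≤ K + 1 → 0 < gB i ∧ gB i ≤ γ)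
    (hpin : gA K = gB (K + 1))
    (hS : ∀ k (w : Fin (k + 2) → ℝ), w ∈ Box γ (k + 1) → |β (k + 1) w - β k (Fin.tail w)| ≤ μ k)
    (hL : HistLipschitz Λ γ β) (hΛ : FadingMemory C θ Λ)
    (hU : ∑ i ∈ range (K + 1), (gA i) ^ 2 * gB (i + 1) ≤ U)
    (hx : ∀ j, 0 < x j) (hanti : ∀ i j, i ≤ j → x j ≤ x i) (hreg : ∀ i j, i ≤ j → θ ^ (j - i) * x i ≤ κ * x j)
    (hsrc : ∀ j, j ≤ K → ∑ i ∈ Ico j K, μ i ≤ x j) (hsmall : C * κ * U ≤ (1 - θ) / 2) :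
    ∀ j, j ≤ K → disc gA gB j ≤ 2 * x j := by
  have hu : ∀ i, i ≤ K → 0 ≤ (gA i) ^ 2 * gB (i + 1) := fun i hi =>
    mul_nonneg (sq_nonneg _) (hBbox (i + 1) (by omega)).1.le
  refine twoSided_fixedPoint_envelope (u := fun i => (gA i) ^ 2 * gB (i + 1)) hθ0 hθ1 hC (disc_nonneg gA gB) hu hU hx hanti hreg
    hsrc hsmall (disc_pin hpin) ?_
  intro j hj
  have hstep := disc_step_of_shiftModulus hA hB hAbox hBbox hS hL (fun k i hik => (hΛ k i hik).1) hj
  have hsum : ∑ i ∈ range (j + 1), Λ j i * ((gA i) ^ 2 * gB (i + 1)) * disc gA gB i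
      ≤ C * ∑ i ∈ range (j + 1), θ ^ (j - i) * ((gA i) ^ 2 * gB (i + 1)) * disc gA gB i := by
    rw [Finset.mul_sum]
    refine Finset.sum_le_sum fun i hi => ?_
    have hij : i ≤ j := Nat.lt_succ_iff.mp (mem_range.mp hi)
    have hiK : i ≤ K := by omega
    have hnn : 0 ≤ (gA i) ^ 2 * gB (i + 1) * disc gA gB i := mul_nonneg (hu i hiK) (disc_nonneg _ _ _)
    calc Λ j i * ((gA i) ^ 2 * gB (i + 1)) * disc gA gB i
        = Λ j i * ((gA i) ^ 2 * gB (i + 1) * disc gA gB i) := by ring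
      _ ≤ C * θ ^ (j - i) * ((gA i) ^ 2 * gB (i + 1) * disc gA gB i) := mul_le_mul_of_nonneg_right (hΛ j i hij).2 hnn
      _ = C * (θ ^ (j - i) * ((gA i) ^ 2 * gB (i + 1)) * disc gA gB i) := by ring
  linarith [hstep, hsum]

/-! ## §3 The family of IR-pinned runs and the junction with PART 1 -/

/-- ★ **NODE U2, MAIN FORM, FOR THE FAMILY OF RUNS under a scale-shift MODULUS with a θ-regular envelope of its TAILS — the injected modulus is `2·x`** (envelope
edition of `T4CouplingMatching.injectedRate_of_runs_eventual`): runs `g K` of (0.20) of every length, couplings in `]0,γ]`, IR-pinned at one `gIR`; `HistLipschitz` +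
`FadingMemory C θ Λ`; the EVENTUAL asymptotic-freedom floor `EventualLowerH b γ k₀ β` (weights `≤ (k₀+1)γ³ + 2γ∕b`, K-uniform); a SUMMABLE modulus `μ` of the full β
(`0 < γ`) whose tails lie under the envelope, `Σ'_i μ_{i+j} ≤ x_j`, `x > 0` antitone and θ-regular; SMALLNESS `C·κ·((k₀+1)γ³ + 2γ∕b) ≤ (1−θ)∕2`.  THEN for every `K`
and `j ≤ K`: `0 ≤ disc (g K) (g (K+1)) j ≤ 2·x_j`.  (Inhabited by name: `…N17ShiftModulusCrossoverWitness.inhabits_injectedModulus_fadingMemory` ∕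
`exists_histDep_inhabitant_fadingMemory`.) [cite: Balaban1987RG1, (0.20) p.256, (0.31) p.259, §5 p.298] -/
theorem injectedModulus_of_runs_fadingMemory_shiftModulus {β : HBeta} {γ b C θ κ : ℝ} {k₀ : ℕ} {μ x : ℕ → ℝ} {Λ : ℕ → ℕ → ℝ}
    (g : ℕ → ℕ → ℝ) (gIR : ℝ) (hγ : 0 < γ) (hb : 0 < b) (hθ0 : 0 ≤ θ) (hθ1 : θ < 1) (hC : 0 ≤ C)
    (hrun : ∀ K, RGEqH K β (g K)) (hbox : ∀ K i, i ≤ K → 0 < g K i ∧ g K i ≤ γ) (hpin : ∀ K, g K K = gIR)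
    (hS : ∀ k (w : Fin (k + 2) → ℝ), w ∈ Box γ (k + 1) → |β (k + 1) w - β k (Fin.tail w)| ≤ μ k)
    (hL : HistLipschitz Λ γ β) (hΛ : FadingMemory C θ Λ) (hlo : EventualLowerH b γ k₀ β) (hsum : Summable μ)
    (hx : ∀ j, 0 < x j) (hanti : ∀ i j, i ≤ j → x j ≤ x i) (hreg : ∀ i j, i ≤ j → θ ^ (j - i) * x i ≤ κ * x j)
    (htail : ∀ j, ∑' i, μ (i + j) ≤ x j) (hsmall : C * κ * (((k₀ : ℝ) + 1) * γ ^ 3 + 2 * γ / b) ≤ (1 - θ) / 2) :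
    ∀ K j : ℕ, j ≤ K → 0 ≤ disc (g K) (g (K + 1)) j ∧ disc (g K) (g (K + 1)) j ≤ 2 * x j := by
  have hμ0 : ∀ k, 0 ≤ μ k := shiftModulus_nonneg hγ hS
  intro K j hj
  refine ⟨disc_nonneg _ _ _, ?_⟩
  have hU := sum_weights_le_of_eventualLower hγ hb (hrun K) (hrun (K + 1)) (hbox K) (hbox (K + 1)) hlo
  have hsrc : ∀ j, j ≤ K → ∑ i ∈ Ico j K, μ i ≤ x j := fun j _ => (sum_Ico_le_tsum_tail hμ0 hsum j K).trans (htail j)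
  exact disc_le_envelope_of_fadingMemory_shiftModulus hθ0 hθ1 hC (hrun K) (hrun (K + 1)) (hbox K) (hbox (K + 1))
    ((hpin K).trans (hpin (K + 1)).symm) hS hL hΛ hU hx hanti hreg hsrc hsmall j hj

/-- ★★ **THE JUNCTION WITH PART 1 ON THE FADING-MEMORY READING**: under §3's hypotheses, an envelope `x` that is `p`-summable at an ADMISSIBLE exponent
(`0 ≤ p ≤ 1`, `a^{1−p}·Λ^p < 1`, `Σ_j x_j^p < ∞`) makes the crossover sums with the two runs' ACTUAL injected discrepancies, `K ↦ Σ_{j+n=K} min(aⁿ, disc (g K) (g (K+1)) j·Λⁿ)`,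
summable over `K` (PART 1 `summable_crossover_of_injectedModulus_rpowSummable` at `r = 2·x`).  What the N19′ crossover needs of node N17 on this reading: a θ-regular
antitone envelope of the shift modulus' tails, `p`-summable below PART 1's threshold `σ⋆(a, Λ)`. [folklore] -/
theorem summable_crossover_of_runs_fadingMemory_shiftModulus {β : HBeta} {γ b C θ κ a Λm p : ℝ} {k₀ : ℕ} {μ x : ℕ → ℝ} {Λ : ℕ → ℕ → ℝ}
    (g : ℕ → ℕ → ℝ) (gIR : ℝ) (hγ : 0 < γ) (hb : 0 < b) (hθ0 : 0 ≤ θ) (hθ1 : θ < 1) (hC : 0 ≤ C)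
    (hrun : ∀ K, RGEqH K β (g K)) (hbox : ∀ K i, i ≤ K → 0 < g K i ∧ g K i ≤ γ) (hpin : ∀ K, g K K = gIR)
    (hS : ∀ k (w : Fin (k + 2) → ℝ), w ∈ Box γ (k + 1) → |β (k + 1) w - β k (Fin.tail w)| ≤ μ k)
    (hL : HistLipschitz Λ γ β) (hΛ : FadingMemory C θ Λ) (hlo : EventualLowerH b γ k₀ β) (hsum : Summable μ)
    (hx : ∀ j, 0 < x j) (hanti : ∀ i j, i ≤ j → x j ≤ x i) (hreg : ∀ i j, i ≤ j → θ ^ (j - i) * x i ≤ κ * x j)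
    (htail : ∀ j, ∑' i, μ (i + j) ≤ x j) (hsmall : C * κ * (((k₀ : ℝ) + 1) * γ ^ 3 + 2 * γ / b) ≤ (1 - θ) / 2)
    (ha : 0 ≤ a) (hΛm : 0 ≤ Λm) (hp0 : 0 ≤ p) (hp1 : p ≤ 1) (hq : a ^ (1 - p) * Λm ^ p < 1) (hxs : Summable fun j => x j ^ p) :
    Summable fun K => ∑ y ∈ antidiagonal K, min (a ^ y.2) (disc (g K) (g (K + 1)) y.1 * Λm ^ y.2) := by
  have hinj := injectedModulus_of_runs_fadingMemory_shiftModulus g gIR hγ hb hθ0 hθ1 hC hrun hbox hpin hS hL hΛ hlo hsum hx hanti hreg htail hsmall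
  have hs : Summable fun j => (2 * x j) ^ p := by
    refine (hxs.mul_left ((2 : ℝ) ^ p)).congr fun j => ?_
    rw [Real.mul_rpow zero_le_two (hx j).le]
  exact summable_crossover_of_injectedModulus_rpowSummable (r := fun j => 2 * x j) hinj ha hΛm hp0 hp1 hq hs

/-! ## §4 The geometric instance on the fading-memory reading: NE4 as typed, one rate `θ` shared with the memory (the tree's convention) -/

/-- ★ **NE4 AS TYPED FEEDS A SUMMABLE CROSSOVER ON THE FADING-MEMORY READING TOO**: runs as in §3 with `ScaleShiftRate c θ γ β` and `FadingMemory C θ Λ` at ONE rate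
`0 < θ < 1` («rates can always be worsened», `T4CouplingMatching.FadingMemory`), under the TREE's smallness `C·((k₀+1)γ³ + 2γ∕b) ≤ (1−θ)∕2` (κ = 1 for the geometric
envelope `x_j = ((c+1)∕(1−θ))·θ^j`: positive, antitone, `θ^{j−i}·x_i = x_j`) ⟹ for every contraction `0 < a < 1` and multiplicity base `Λ ≥ 0` the crossover sums with
the actual injected discrepancies are summable over `K`.  Consistent with `disc_le_of_fadingMemory` + `T4Crossover.summable_sum_min_pow` (constant `2(c+1)` for `2c`),
reached through the envelope road. [folklore] -/
theorem summable_crossover_of_runs_fadingMemory_scaleShiftRate {β : HBeta} {γ b C θ c a Λm : ℝ} {k₀ : ℕ} {Λ : ℕ → ℕ → ℝ}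
    (g : ℕ → ℕ → ℝ) (gIR : ℝ) (hγ : 0 < γ) (hb : 0 < b) (hθ0 : 0 < θ) (hθ1 : θ < 1) (hC : 0 ≤ C)
    (hrun : ∀ K, RGEqH K β (g K)) (hbox : ∀ K i, i ≤ K → 0 < g K i ∧ g K i ≤ γ) (hpin : ∀ K, g K K = gIR)
    (hS : ScaleShiftRate c θ γ β) (hL : HistLipschitz Λ γ β) (hΛ : FadingMemory C θ Λ) (hlo : EventualLowerH b γ k₀ β)
    (hsmall : C * (((k₀ : ℝ) + 1) * γ ^ 3 + 2 * γ / b) ≤ (1 - θ) / 2)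
    (ha0 : 0 < a) (ha1 : a < 1) (hΛm : 0 ≤ Λm) :
    Summable fun K => ∑ y ∈ antidiagonal K, min (a ^ y.2) (disc (g K) (g (K + 1)) y.1 * Λm ^ y.2) := by
  have hS' : ∀ k (w : Fin (k + 2) → ℝ), w ∈ Box γ (k + 1) → |β (k + 1) w - β k (Fin.tail w)| ≤ (fun k => c * θ ^ k) k := hS
  have hμ0 : ∀ k, 0 ≤ c * θ ^ k := shiftModulus_nonneg hγ hS'
  have hc : 0 ≤ c := by simpa using hμ0 0
  have h1θ : 0 < 1 - θ := by linarith
  have hsum : Summable fun k => c * θ ^ k := summable_of_geometric_shiftModulus hθ0.le hθ1 hμ0 fun _ => le_rfl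
  -- the geometric envelope `x_j = ((c+1)/(1−θ)) θ^j`
  set x : ℕ → ℝ := fun j => (c + 1) / (1 - θ) * θ ^ j with hxdef
  have hE : 0 < (c + 1) / (1 - θ) := div_pos (by linarith) h1θ
  have hx : ∀ j, 0 < x j := fun j => mul_pos hE (pow_pos hθ0 j)
  have hanti : ∀ i j, i ≤ j → x j ≤ x i := fun i j hij =>
    mul_le_mul_of_nonneg_left (pow_le_pow_of_le_one hθ0.le hθ1.le hij) hE.le
  have hreg : ∀ i j, i ≤ j → θ ^ (j - i) * x i ≤ 1 * x j := fun i j hij => by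
    have e : θ ^ (j - i) * θ ^ i = θ ^ j := by rw [← pow_add, Nat.sub_add_cancel hij]
    have h : θ ^ (j - i) * x i = 1 * x j := by
      calc θ ^ (j - i) * x i = (c + 1) / (1 - θ) * (θ ^ (j - i) * θ ^ i) := by simp only [hxdef]; ring
        _ = 1 * x j := by rw [e]; simp only [hxdef]; ring
    exact h.le
  have htail : ∀ j, ∑' i, (fun k => c * θ ^ k) (i + j) ≤ x j := fun j => by
    have h := tail_le_of_geometric_shiftModulus hθ0.le hθ1 hμ0 (fun _ => le_rfl) j
    refine h.trans ?_
    simp only [hxdef]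
    exact mul_le_mul_of_nonneg_right (div_le_div_of_nonneg_right (by linarith) h1θ.le) (pow_nonneg hθ0.le j)
  have hsmall' : C * 1 * (((k₀ : ℝ) + 1) * γ ^ 3 + 2 * γ / b) ≤ (1 - θ) / 2 := by rw [mul_one]; exact hsmall
  obtain ⟨p, hp0, hp1, hq⟩ := exists_crossover_admissible_exponent ha0 ha1 hΛm
  have hxs : Summable fun j => x j ^ p :=
    rpowSummable_of_geometric_modulus (C := (c + 1) / (1 - θ)) hθ0.le hθ1 (fun j => (hx j).le) (fun j => le_rfl) hp0
  exact summable_crossover_of_runs_fadingMemory_shiftModulus g gIR hγ hb hθ0.le hθ1 hC hrun hbox hpin hS' hL hΛ hlo hsum hx hanti hreg htail hsmall'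
    ha0.le hΛm hp0.le hp1 hq hxs

end Summit.QuantumFields.YangMills.BalabanUVNodes.N17ShiftModulusCrossoverU2Fading

end
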